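import Summits.QuantumFields.BalabanUV.T4Continuum.Support.NE3FrameFreeDecompositionW
import Summits.QuantumFields.BalabanUV.T4Continuum.Support.NE3SlicePoincareShape
import Summits.QuantumFields.BalabanUV.T4Continuum.Support.NE3LiftDefectCorrection
import HarnessLib

/-!
# NE7OneLevelSliceStep — THE ONE-LEVEL STEP OF THE HIERARCHICAL REPRESENTATIVE: every lift `Z` of a coarse datum `w` is moved by a CORNER-TRIVIAL gauge onto
# `R + J`, `R` any exact lift of `w`, `J` in row NE3's one-level frame-free block-Landau slice `T_♮(W,1)`; and with (P♮)_W at one level the slice part is paid by curl: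
# `‖J‖ ≤ √C_P·L·(√curlSq X′ + √curlSq R)`, `‖X′‖ ≤ ‖R‖ + ‖J‖` (root form)
# (lineage `b2b-balaban-t4-ne7b-p1`, gen 162; route (H′) of memo `t4/b2b-balaban-t4-ne7b-p1/g162/records/SCOPING-LEVELMASSES.md` §3∕§8, file (M))

Cell `pub-balaban`, rung (B)+1 sub-cell t4, lineage `b2b-balaban-t4-ne7b-p1` (row NE7b OWNER + CRUX PROVER; junction service for row NE7 on ROAD-G116 §6 (G3)), generation 162.
WHY.  The corrected route (H′) (memo §8; budget ✓∕→ `NE7LevelMassBudget`) builds the representative of a fibre element top-down: at level `i`, the incoming level-`i` field `Z`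
(a lift of the already-built `X′_{i+1} =: w`: `cpush_{W_i} Z = w`) is moved INSIDE ITS CORNER-TRIVIAL GAUGE CLASS onto `X′_i := R w + J_i` with `R` the exact one-step lift of record and
`J_i ∈ T_♮(W_i, 1)`.  This file is that step, over row NE3's one-level theorems BY NAME: (E_W) at `j = 0` (✓ `NE3FrameFreeDecompositionW.exists_cornerGauge_mem_frameFreeBlockLandauW`,
applied to `Z − R w ∈ ker cpush_{W}`) and (P♮)_W at `k = 1` as the displayed hypothesis `SlicePoincare L 1 W (frameFreeBlockLandauW L M 1 W) C_P F` (✓ `NE3SlicePoincareShape.SlicePoincare`;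
discharged on the class by ✓ `NE3ClassSlicePoincare.classSlicePoincare_of_lines` at `j = 0`).  The corner-trivial gauge at level `i` is a DEPTH-`i` fine gauge — the assembly into one
top-corner-trivial fine gauge is kinematics (memo §3 (K)) and not here.
WHAT ([folklore]; 0 def, 0 sorry; `d` arbitrary, ONE level: base `W` unitary `(tower L M 1)`-periodic with `0 ≤ x`, `LevelSmall d L 0 x`, `SmallField W x`):
§1 linearity bookkeeping: `cpush_sub_fun` (class), `curlAt_neg`, `curlSq_neg`, `dirSq_neg`, `sqrt_curlSq_sub_le`, `sqrt_dirSq_sub_le`;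
§2 **`exists_sliceStep`** (`L ≥ 1`, `L^d ≥ 2`): for skew periodic `Z`, `R` with `cpush L W Z = w = cpush L W R` there is a skew, periodic, CORNER-TRIVIAL (`μ (L•w′) = 0`) gauge `μ` and
   `J ∈ frameFreeBlockLandauW L M 1 W` with **`Z + gaugeDir W μ = R + J`**, `cpush L W J = 0`, `cpush L W (Z + gaugeDir W μ) = w`;
§3 **`sliceStep_letters`**: under `SlicePoincare L 1 W (frameFreeBlockLandauW L M 1 W) C F` (`0 ≤ C`, `1 ≤ L`), for `J ∈ T_♮(W,1)` and `X′ = R + J`: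
   `dirSq J F ≤ C·L²·curlSq W J F`, **`√dirSq J F ≤ √C·L·(√curlSq W X′ F + √curlSq W R F)`**, **`√dirSq X′ F ≤ √dirSq R F + √C·L·(√curlSq W X′ F + √curlSq W R F)`** — the (S) letters
   of memo §8 in root form: the slice part of the level mass is paid by the level's curl energy and the lift's curl (the lift's mass and curl letters are the lift file's).
HONEST FRAMING (page 1): composition of row NE3's landed one-level theorems about OUR objects; nothing of Bałaban's asserted ([Balaban1985Averaging] (42), (110)–(125); [Balaban1985Variational]
(83) context only); NOT the lift, NOT (G3), NOT (G), NOT NE7∕NE3 as spine nodes; row NE7b NOT PRINTED ∕ NOT PROVED; spine 0∕9; finite T⁴ rung (B)+1 — NOT infinite volume, NOT mass gap,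
NOT BetaPertH, NOT Clay.
-/

set_option autoImplicit false

open scoped BigOperators Matrix Matrix.Norms.L2Operator
open Finset

namespace Summit.QuantumFields.BalabanUV.T4Continuum.NE7OneLevelSliceStep

open Literature.MathematicalPhysics.QuantumFieldTheory.Balaban1983to89
open B7Prop1Explicit B7Prop2Explicit
open T4AveragingDeficitWall (IsUnitaryCfg IsSkewDir SmallField Ad curl curlAt curlSq dirSq)
open T4AveragingDeficitWallBoundary (IsPeriodicCfg)
open AveragingDeficitPeriodicCounting (IsPeriodicDir)
open AveragingDeficitNearIdentity (Ad_neg)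
open AveragingDeficitResidualPairing (pushDir)
open AveragingDeficitPushForwardLinear (pushDir_add pushDir_smul)
open AveragingDeficitMultiLevelPrep (cpush tower TangentIter LevelSmall)
open BlockAveragePushDirGauge (gaugeDir)
open NE3TangentCovariantStructure (cpush_add norm_Wcx_sub_one_le_32)
open NE3TangentCovariantTower (step_small)
open NE3SlicePoincareShape (SlicePoincare)
open NE3FrameFreeSliceW (frameFreeBlockLandauW)
open NE3FrameFreeDecompositionW (exists_cornerGauge_mem_frameFreeBlockLandauW)
open NE3LiftDefectCorrection (sqrt_dirSq_add_le sqrt_curlSq_add_le)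

noncomputable section

variable {d : ℕ} {n : Type*} [Fintype n] [DecidableEq n]

/-! ## §1 Linearity bookkeeping -/

/-- `cpush` of a pointwise difference in the one-level class (`L ≥ 1`; `W` unitary, `0 ≤ x`, `LevelSmall d L 0 x`, `SmallField W x`). [folklore] -/
theorem cpush_sub_fun [Nonempty n] {L : ℕ} (hL : 1 ≤ L) {W : Site d → Fin d → (Matrix n n ℂ)ˣ} {x : ℝ} (hWu : IsUnitaryCfg W)
    (hx : 0 ≤ x) (hs : LevelSmall d L 0 x) (hWx : SmallField W x) (A B : Site d → Fin d → Matrix n n ℂ) :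
    cpush L W (fun y μ => A y μ - B y μ) = fun z κ => cpush L W A z κ - cpush L W B z κ := by
  obtain ⟨h512, -, -, -⟩ := step_small hL hWu hx hs.two hWx
  funext z κ
  have hW := fun r => norm_Wcx_sub_one_le_32 hL hWu hx h512 hWx ((L : ℤ) • z) κ r
  have hAB : (fun y μ => A y μ - B y μ) = A + (-1 : ℝ) • B := by
    funext y μ
    rw [Pi.add_apply, Pi.add_apply, Pi.smul_apply, Pi.smul_apply, neg_one_smul, ← sub_eq_add_neg]
  show pushDir L W (fun y μ => A y μ - B y μ) ((L : ℤ) • z) κ = pushDir L W A ((L : ℤ) • z) κ - pushDir L W B ((L : ℤ) • z) κ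
  rw [hAB, pushDir_add L W _ _ _ κ hW, pushDir_smul L W _ _ _ κ hW, neg_one_smul, ← sub_eq_add_neg]

/-- The dressed curl of the negative. [folklore] -/
theorem curlAt_neg (V : Site d → Fin d → (Matrix n n ℂ)ˣ) (ψ : Site d → Fin d → Matrix n n ℂ) (z : Site d) (μ ν : Fin d) :
    curlAt V (-ψ) z μ ν = -curlAt V ψ z μ ν := by
  simp only [curlAt, Pi.neg_apply, Ad_neg]
  abel

/-- `curlSq V (−ψ) F = curlSq V ψ F`. [folklore] -/
theorem curlSq_neg (V : Site d → Fin d → (Matrix n n ℂ)ˣ) (ψ : Site d → Fin d → Matrix n n ℂ) (F : Finset (Site d)) :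
    curlSq V (-ψ) F = curlSq V ψ F := by
  unfold curlSq curl
  simp_rw [curlAt_neg, norm_neg]

/-- `dirSq (−ψ) F = dirSq ψ F`. [folklore] -/
theorem dirSq_neg (ψ : Site d → Fin d → Matrix n n ℂ) (F : Finset (Site d)) : dirSq (-ψ) F = dirSq ψ F := by
  unfold dirSq
  simp_rw [Pi.neg_apply, norm_neg]

/-- Minkowski for a difference, curl energy: `√curlSq V (ψ − η) F ≤ √curlSq V ψ F + √curlSq V η F`. [folklore] -/
theorem sqrt_curlSq_sub_le (V : Site d → Fin d → (Matrix n n ℂ)ˣ) (ψ η : Site d → Fin d → Matrix n n ℂ) (F : Finset (Site d)) :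
    Real.sqrt (curlSq V (ψ - η) F) ≤ Real.sqrt (curlSq V ψ F) + Real.sqrt (curlSq V η F) := by
  rw [sub_eq_add_neg, ← curlSq_neg V η F]
  exact sqrt_curlSq_add_le V ψ (-η) F

/-- Minkowski for a difference, bond mass: `√dirSq (ψ − η) F ≤ √dirSq ψ F + √dirSq η F`. [folklore] -/
theorem sqrt_dirSq_sub_le (ψ η : Site d → Fin d → Matrix n n ℂ) (F : Finset (Site d)) :
    Real.sqrt (dirSq (ψ - η) F) ≤ Real.sqrt (dirSq ψ F) + Real.sqrt (dirSq η F) := by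
  rw [sub_eq_add_neg, ← dirSq_neg η F]
  exact sqrt_dirSq_add_le ψ (-η) F

/-! ## §2 The one-level slice step: existence -/

/-- **THE ONE-LEVEL SLICE STEP — EXISTENCE** (`L ≥ 1`, `L^d ≥ 2`; base `W` unitary, `(tower L M 1)`-periodic, `0 ≤ x`, `LevelSmall d L 0 x`, `SmallField W x`).  Let `Z` and `R` be
skew, `(tower L M 1)`-periodic level fields with the SAME one-step linearised average, `cpush L W Z = w = cpush L W R` (`Z` the incoming lift, `R` the exact lift of record applied to `w`).
Then there is a 𝔲(n)-valued, `(tower L M 1)`-periodic, CORNER-TRIVIAL (`μ (L•w′) = 0`) gauge generator `μ` and a slice element `J ∈ frameFreeBlockLandauW L M 1 W` with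
`Z + gaugeDir W μ = R + J`, `cpush L W J = 0`, and `cpush L W (Z + gaugeDir W μ) = w` — row NE3's (E_W) at `j = 0` applied to `Z − R ∈ ker cpush_W`. [folklore] -/
theorem exists_sliceStep [Nonempty n] {L M : ℕ} [NeZero M] (hL : 1 ≤ L) (hLd : 2 ≤ L ^ d)
    {W : Site d → Fin d → (Matrix n n ℂ)ˣ} {x : ℝ} (hWu : IsUnitaryCfg W) (hWP : IsPeriodicCfg W ((tower L M 1 : ℕ) : ℤ))
    (hx : 0 ≤ x) (hs : LevelSmall d L 0 x) (hWx : SmallField W x)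
    {Z R w : Site d → Fin d → Matrix n n ℂ} (hZs : IsSkewDir Z) (hZP : IsPeriodicDir Z ((tower L M 1 : ℕ) : ℤ))
    (hRs : IsSkewDir R) (hRP : IsPeriodicDir R ((tower L M 1 : ℕ) : ℤ)) (hZ : cpush L W Z = w) (hR : cpush L W R = w) :
    ∃ mu : Site d → Matrix n n ℂ, (∀ y, mu y ∈ skewAdjoint (Matrix n n ℂ))
      ∧ (∀ (y : Site d) (i : Fin d), mu (y + ((tower L M 1 : ℕ) : ℤ) • e i) = mu y)
      ∧ (∀ w' : Site d, mu ((L : ℤ) • w') = 0)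
      ∧ ∃ J : Site d → Fin d → Matrix n n ℂ, J ∈ frameFreeBlockLandauW (d := d) (n := n) L M 1 W
          ∧ (fun y ν => Z y ν + gaugeDir W mu y ν) = (fun y ν => R y ν + J y ν)
          ∧ cpush L W J = 0
          ∧ cpush L W (fun y ν => Z y ν + gaugeDir W mu y ν) = w := by
  obtain ⟨h512, -, -, -⟩ := step_small hL hWu hx hs.two hWx
  -- the kernel element `Y = Z − R`
  set Y : Site d → Fin d → Matrix n n ℂ := fun y ν => Z y ν - R y ν with hYdef
  have hYs : IsSkewDir Y := fun y ν => (skewAdjoint (Matrix n n ℂ)).sub_mem (hZs y ν) (hRs y ν)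
  have hYP : IsPeriodicDir Y ((tower L M 1 : ℕ) : ℤ) := fun y i ν => by simp only [hYdef, hZP y i ν, hRP y i ν]
  have hYT : TangentIter L 0 W Y := by
    show cpush L W Y = 0
    rw [hYdef, cpush_sub_fun hL hWu hx hs hWx Z R, hZ, hR]
    funext z κ
    simp
  -- row NE3's (E_W) at `j = 0`
  obtain ⟨mu, hmus, hmuP, hmu0, hmem⟩ := exists_cornerGauge_mem_frameFreeBlockLandauW hL hLd 0 hWu hWP hx hs hWx hYs hYP hYT
  have hmu0' : ∀ w' : Site d, mu ((L : ℤ) • w') = 0 := fun w' => by simpa using hmu0 w'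
  set J : Site d → Fin d → Matrix n n ℂ := fun y ν => Y y ν + gaugeDir W mu y ν with hJdef
  have hJT : TangentIter L 0 W J := hmem.2.2.1
  have hJ0 : cpush L W J = 0 := hJT
  have hid : (fun y ν => Z y ν + gaugeDir W mu y ν) = (fun y ν => R y ν + J y ν) := by
    funext y ν
    simp only [hJdef, hYdef]
    abel
  refine ⟨mu, hmus, hmuP, hmu0', J, hmem, hid, hJ0, ?_⟩
  rw [hid, cpush_add hL hWu hx h512 hWx R J, hR, hJ0]
  funext z κ
  simp

/-! ## §3 The one-level slice step: the (S) letters under (P♮)_W at one level -/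

/-- **THE (S) LETTERS OF THE ONE-LEVEL STEP** (`L ≥ 1`, `0 ≤ C`): under row NE3's one-level slice Poincaré inequality `SlicePoincare L 1 W (frameFreeBlockLandauW L M 1 W) C F`, for
`J ∈ frameFreeBlockLandauW L M 1 W` and `X′ = R + J`:
`dirSq J F ≤ C·L²·curlSq W J F`, `√dirSq J F ≤ √C·L·(√curlSq W X′ F + √curlSq W R F)`, and `√dirSq X′ F ≤ √dirSq R F + √C·L·(√curlSq W X′ F + √curlSq W R F)`. [folklore] -/
theorem sliceStep_letters {L M : ℕ} (hL : 1 ≤ L) {W : Site d → Fin d → (Matrix n n ℂ)ˣ} {C : ℝ} (hC : 0 ≤ C) {F : Finset (Site d)}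
    (hP : SlicePoincare L 1 W (frameFreeBlockLandauW (d := d) (n := n) L M 1 W) C F)
    {X R J : Site d → Fin d → Matrix n n ℂ} (hJ : J ∈ frameFreeBlockLandauW (d := d) (n := n) L M 1 W)
    (hX : X = fun y ν => R y ν + J y ν) :
    dirSq J F ≤ C * (L : ℝ) ^ 2 * curlSq W J F
      ∧ Real.sqrt (dirSq J F) ≤ Real.sqrt C * L * (Real.sqrt (curlSq W X F) + Real.sqrt (curlSq W R F))
      ∧ Real.sqrt (dirSq X F) ≤ Real.sqrt (dirSq R F) + Real.sqrt C * L * (Real.sqrt (curlSq W X F) + Real.sqrt (curlSq W R F)) := by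
  have hL0 : (0 : ℝ) < L := by exact_mod_cast (show 0 < L by omega)
  have hcurl0 : ∀ (Y : Site d → Fin d → Matrix n n ℂ), 0 ≤ curlSq W Y F := fun Y => by unfold curlSq; positivity
  -- (P♮)_W at one level, multiplied out
  have h1 : dirSq J F ≤ C * (L : ℝ) ^ 2 * curlSq W J F := by
    have h := hP J hJ
    rw [pow_one] at h
    have hL2 : (0 : ℝ) < (L : ℝ) ^ 2 := by positivity
    have e : dirSq J F = (L : ℝ) ^ 2 * (((L : ℝ)⁻¹) ^ 2 * dirSq J F) := by
      rw [← mul_assoc, inv_pow, mul_inv_cancel₀ hL2.ne', one_mul]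
    rw [e]
    calc (L : ℝ) ^ 2 * (((L : ℝ)⁻¹) ^ 2 * dirSq J F) ≤ (L : ℝ) ^ 2 * (C * curlSq W J F) := mul_le_mul_of_nonneg_left h hL2.le
      _ = _ := by ring
  -- `J = X − R`, Minkowski on the curl
  have hJXR : J = X - R := by
    rw [hX]; funext y ν; simp
  have h2 : Real.sqrt (dirSq J F) ≤ Real.sqrt C * L * (Real.sqrt (curlSq W X F) + Real.sqrt (curlSq W R F)) := by
    have hs1 : Real.sqrt (dirSq J F) ≤ Real.sqrt (C * (L : ℝ) ^ 2 * curlSq W J F) := Real.sqrt_le_sqrt h1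
    have hs2 : Real.sqrt (C * (L : ℝ) ^ 2 * curlSq W J F) = Real.sqrt C * L * Real.sqrt (curlSq W J F) := by
      rw [Real.sqrt_mul (by positivity), Real.sqrt_mul hC, Real.sqrt_sq hL0.le]
    have hs3 : Real.sqrt (curlSq W J F) ≤ Real.sqrt (curlSq W X F) + Real.sqrt (curlSq W R F) := by
      rw [hJXR]; exact sqrt_curlSq_sub_le W X R F
    rw [hs2] at hs1
    exact hs1.trans (mul_le_mul_of_nonneg_left hs3 (by positivity))
  refine ⟨h1, h2, ?_⟩
  have hXRJ : X = R + J := by rw [hX]; rfl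
  have h3 : Real.sqrt (dirSq X F) ≤ Real.sqrt (dirSq R F) + Real.sqrt (dirSq J F) := by
    rw [hXRJ]; exact sqrt_dirSq_add_le R J F
  linarith

end

end Summit.QuantumFields.BalabanUV.T4Continuum.NE7OneLevelSliceStep
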